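import Summits.ResolutionOfSingularities.ResolutionOfSingularities.Theorems.PurelyInseparableDim4ChartAtlasSNCGoodFarEscapingCharts
import Summits.ResolutionOfSingularities.ResolutionOfSingularities.Theorems.PurelyInseparableDim4ChartAtlasSNCGoodFar
import HarnessLib

/-!
# Purely inseparable four-folds `z^p + F(x₁, …, x₄)`: the FAR POSITIVE of the S3-N2 dichotomy ON `W`, escaping case `j ∉ S'` — the
# escaping global centre is snc with the whole transformed NEAR/FAR boundary when no two active far members share a height (typ-2 g6)

[OURS · counted 0] (D-0157 DOOR 2; DR-157-C; desk WORD #115 (a)/(c), #131 (c); typ-2 g5 HANDOFF OPEN item 1 «positives with far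
members for `j ∉ S'`»). Setting of the S3-N1 atlas (p688534): `π : W → 𝔸⁵` ANY blowing up along `V(z, x_S)`, the walk's point `b` on the
`x_j`-chart (`j ∈ S`, `b_j = 0`), re-centring `Θⱼ` of record, next centre variables `S' ∌ j` (ESCAPING case) with `F₁` `S'`-permissible,
`Zc` = closure of `φⱼ(V(z, x_{S'}))`. Old boundary `E = [(xᵢ + cᵢ)·𝒪 : i ∈ ms] ++ [(xᵢ + dᵢ)·𝒪 : i ∈ fs]`: NEAR members (`c = 0` on
`S`) and FAR members (`i ∈ S`, `dᵢ ≠ 0`, indices not in `ms`). PROVED here (no `sorry`, no new axiom):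

* **`hasSNCWith_transform_boundary_globalCentre_of_far_heights`** — if (near) `{x_j = 0} ∈ E ⟹` no near member is sheared INTO the
  new centre (`m ∈ ms ∩ S ∩ S' ⟹ b_m = 0`) and at most one near member is (the `|B| ≤ 1` of p690374/p691155/p698330, both good cases at
  once), and (far) NO TWO ACTIVE FAR MEMBERS SHARE A HEIGHT — `dᵢ ≠ bᵢ·d_j` for `i ∈ fs ∩ S'`, `bᵢ ≠ 0`, when `j ∈ fs`, and
  `dᵢ·b_k ≠ d_k·bᵢ` for `i ≠ k ∈ fs ∩ S'`, `bᵢ, b_k ≠ 0` —, then `HasSNCWith ((⟨(z^p+F)·𝒪, E, p⟩.transform π 𝓘Λ_S).boundary) Zc`.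

This is the exact converse of FAR RESONANCE (p699206 `not_hasSNCWith_globalCentre_of_far_resonance`, p699584 twin form): on `W`, in
the escaping case, «`Zc` snc with the transformed boundary ⟸ `|B_near| ≤ 1` ∧ pairwise distinct active far heights», and each failure
of the two conditions is a kernel obstruction (p690374/p690709, p699206/p699584) — the by-hand criterion of `S3-N2-SNC-CRITERION.md`
§05:30Z is now ‖ K in both directions. Proof: the old boundary is snc with `V(z, x_S)` (p699951 `hasSNCWith_nearFar_𝓘Λ`), so the
transformed boundary is snc on `W` (`HasSNCWith.hasSNC_transform`); `V(Zc)` is covered by the charts `x_l`, `l ∈ S ∖ S'` (p688180);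
chart by chart p703421-file (`hasSNCWith_boundary_readings_translate_chart_far` / `_shear_chart_far`, i.e. the Jacobian engine
p701374 through p701847/p702981); glue p692083. Nothing here is a statement about resolution of singularities in dimension ≥ 4 /
characteristic `p` (NOT proved anywhere in this programme). bears_on: LADDER-RESOLUTION:D157-DOOR2 (res-dim4-pi). Supports
stmt-ResolutionOfSingularities-16155 (helper, S3-N2 positive side with far members).
-/

-- every declaration of this summit lives under `Summit.ResolutionOfSingularities.ResolutionOfSingularities`
-- (summit = problem), which the duplicate-namespace linter flags; house convention (cf. the Target file).
set_option linter.dupNamespace false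

noncomputable section

open MvPolynomial Finset CategoryTheory AlgebraicGeometry Opposite TopologicalSpace
open AlgebraicGeometry.Scheme.IdealSheafData (ofIdealTop vanishingIdeal)

namespace Summit.ResolutionOfSingularities.ResolutionOfSingularities.Theorems.PIDim4

open Literature.AlgebraicGeometry.Resolution
open Literature.AlgebraicGeometry.Resolution.Hauser2010
open Literature.AlgebraicGeometry.Resolution.AffinePointBlowup (P A γ coord Wtop ξ)
open Literature.Barriers.ResolutionOfSingularities

namespace ChartDictionary

variable {K : Type} [Field K] {p : ℕ} [hp : Fact p.Prime] [CharP K p]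
  {S S' : Finset (Fin 4)} {j : Fin 4} {b : Fin 4 → K} {Θⱼ : A 4 K ≃ₐ[K] A 4 K} {h : MvPolynomial (Fin 4) K}
  {F F₁ : MvPolynomial (Fin 4) K} {W : Scheme.{0}} {π : W ⟶ P 4 K}

/-- **THE FAR POSITIVE OF S3-N2 ON `W` (escaping case `j ∉ S'`): the escaping global centre is snc with the whole transformed near/far
boundary when the near bad set has at most one element and no two active far members share a height.** Old boundary
`E = [(xᵢ + cᵢ)·𝒪 : i ∈ ms] ++ [(xᵢ + dᵢ)·𝒪 : i ∈ fs]` (`c = 0` on `S`; `i ∈ S`, `dᵢ ≠ 0` and `i ∉ ms` on `fs`); `π` ANY blowing up of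
`𝔸⁵` along `V(z, x_S)`; `Θⱼ` the re-centring of record of the `x_j`-chart at `b` (`b_j = 0`) with reading `z^p + F ↦ x_j^p (z^p + F₁)`,
`F ≠ 0` clean `S`-permissible, `F₁` `S'`-permissible, `j ∉ S'`. -/
theorem hasSNCWith_transform_boundary_globalCentre_of_far_heights [IsAlgClosed K] (hj : j ∈ S) (hjS' : j ∉ S') (hbj : b j = 0)
    (hF : F ≠ 0) (hclean : HauserPerlega.IsClean p F) (h0j : Θⱼ (X 0) = X 0 + rename Fin.succ h)
    (hsj : ∀ i : Fin 4, Θⱼ (X i.succ) = X i.succ + C (b i))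
    (hπ : IsBlowup π (AffineCoordBlowup.𝓘Λ 4 K (insert 0 (Fin.succ '' (S : Set (Fin 4))))))
    (hperm : (p : ℕ∞) ≤ CentreBlowup.ordAlong S F)
    (hread : Θⱼ (coordBlowupSubst K (insert 0 (Fin.succ '' (S : Set (Fin 4)))) j.succ (hyp p F)) = X j.succ ^ p * hyp p F₁)
    (hperm' : (p : ℕ∞) ≤ CentreBlowup.ordAlong S' F₁) (ms fs : List (Fin 4)) (c d : Fin 4 → K) (hc : ∀ i ∈ S, c i = 0)
    (hfs : ∀ i ∈ fs, i ∈ S ∧ d i ≠ 0) (hdis : ∀ i ∈ fs, i ∉ ms)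
    (hB1 : j ∈ ms → ∀ m ∈ ms, m ∈ S → m ∈ S' → b m = 0)
    (hB2 : ∀ m ∈ ms, ∀ m' ∈ ms, m ∈ S → m' ∈ S → m ∈ S' → m' ∈ S' → b m ≠ 0 → b m' ≠ 0 → m = m')
    (hH1 : ∀ i ∈ fs, i ∈ S' → b i ≠ 0 → j ∈ fs → d i ≠ b i * d j)
    (hH2 : ∀ i ∈ fs, ∀ k ∈ fs, i ≠ k → i ∈ S' → k ∈ S' → b i ≠ 0 → b k ≠ 0 → d i * b k ≠ d k * b i) :
    haveI : IsIso (CommRingCat.ofHom (Θⱼ : A 4 K →+* A 4 K)) := (inferInstance : IsIso Θⱼ.toRingEquiv.toCommRingCatIso.hom)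
    HasSNCWith
      ((⟨hypSheaf p F, (ms.map fun i => ofIdealTop (Ideal.span {(γ 4 K).symm (X i.succ + C (c i))})) ++
          fs.map fun i => ofIdealTop (Ideal.span {(γ 4 K).symm (X i.succ + C (d i))}), p⟩ :
          MarkedIdeal (P 4 K)).transform π (AffineCoordBlowup.𝓘Λ 4 K (insert 0 (Fin.succ '' (S : Set (Fin 4)))))).boundary
      (vanishingIdeal (closureImage
        (Spec.map (CommRingCat.ofHom (Θⱼ : A 4 K →+* A 4 K)) ≫ AffineCoordBlowup.chartImm hπ (succ_mem_centreVars hj))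
        ((AffineCoordBlowup.𝓘Λ 4 K (insert 0 (Fin.succ '' (S' : Set (Fin 4))))).support : Set (P 4 K)))) := by
  classical
  haveI hisoj : IsIso (CommRingCat.ofHom (Θⱼ : A 4 K →+* A 4 K)) :=
    (inferInstance : IsIso Θⱼ.toRingEquiv.toCommRingCatIso.hom)
  haveI : IsProper π := hπ.isProper
  haveI : IsLocallyNoetherian W := LocallyOfFiniteType.isLocallyNoetherian π
  set Λ : Set (Fin (4 + 1)) := insert 0 (Fin.succ '' (S : Set (Fin 4))) with hΛ
  set φⱼ := Spec.map (CommRingCat.ofHom (Θⱼ : A 4 K →+* A 4 K)) ≫ AffineCoordBlowup.chartImm hπ (succ_mem_centreVars hj)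
    with hφⱼ
  set Zc := vanishingIdeal (closureImage φⱼ
    ((AffineCoordBlowup.𝓘Λ 4 K (insert 0 (Fin.succ '' (S' : Set (Fin 4))))).support : Set (P 4 K))) with hZc
  set E : List (Scheme.IdealSheafData (P 4 K)) :=
    (ms.map fun i => ofIdealTop (Ideal.span {(γ 4 K).symm (X i.succ + C (c i))})) ++
      fs.map fun i => ofIdealTop (Ideal.span {(γ 4 K).symm (X i.succ + C (d i))}) with hEdef
  -- (i) the old boundary is snc with the centre `V(z, x_S)`, so the transformed boundary is snc on `W`
  have hE : HasSNCWith E (AffineCoordBlowup.𝓘Λ 4 K Λ) := hasSNCWith_nearFar_𝓘Λ (K := K) (S := S) ms fs c d hdis j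
  have hsncW : HasSNC (((⟨hypSheaf p F, E, p⟩ : MarkedIdeal (P 4 K)).transform π (AffineCoordBlowup.𝓘Λ 4 K Λ)).boundary) := by
    rw [MarkedIdeal.transform_boundary]
    exact hE.hasSNC_transform hπ
  -- (ii) the cover of `V(Zc)` by the charts `x_l`, `l ∈ S ∖ S'`
  have hcov := support_globalCentre_subset_iUnion hj hjS' hbj h0j hsj hπ hperm hread hperm'
  -- (iii) the shear charts `l ≠ j`: re-centrings of the S3-N1 atlas
  have hchart : ∀ l : {l : Fin 4 // l ∈ S \ S'}, l.1 ≠ j →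
      ∃ (Θ : A 4 K ≃ₐ[K] A 4 K) (τ : MvPolynomial (Fin 4) K ≃ₐ[K] MvPolynomial (Fin 4) K)
        (_ : IsIso (CommRingCat.ofHom (Θ : A 4 K →+* A 4 K))),
        (∀ i : Fin 4, Θ (X i.succ) = rename Fin.succ (τ (X i))) ∧ τ (X j) = X j ∧ τ (X l.1) = X l.1 ∧
        (∀ i ∈ S, i ≠ j → i ≠ l.1 → τ (X i) = X i + C (b i) * X j) ∧ (∀ k ∉ S, τ (X k) = X k + C (b k)) ∧
        Zc.comap (Spec.map (CommRingCat.ofHom (Θ : A 4 K →+* A 4 K)) ≫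
            AffineCoordBlowup.chartImm hπ (succ_mem_centreVars (Finset.mem_sdiff.mp l.2).1)) =
          AffineCoordBlowup.𝓘Λ 4 K (insert 0 (Fin.succ '' (S' : Set (Fin 4)))) := by
    intro l hlj
    obtain ⟨hlS, hlS'⟩ := Finset.mem_sdiff.mp l.2
    obtain ⟨Θ, τ, g, hiso, -, hτ, hτj, hτl, hτS, hτk, -, hZ, -, -, -, -⟩ :=
      exists_shear_chart_reading hj hjS' hbj hF hclean h0j hsj hπ hperm hread hperm' hlS hlS' (Ne.symm hlj)
    exact ⟨Θ, τ, hiso, hτ, hτj, hτl, hτS, hτk, hZ⟩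
  choose Θf τf hisof hτf hτjf hτlf hτSf hτkf hZf using hchart
  -- the family of re-centred chart immersions
  let U : {l : Fin 4 // l ∈ S \ S'} → Scheme.{0} := fun _ => P 4 K
  let φ : ∀ l : {l : Fin 4 // l ∈ S \ S'}, U l ⟶ W := fun l =>
    if hlj : l.1 = j then φⱼ
    else Spec.map (CommRingCat.ofHom (Θf l hlj : A 4 K →+* A 4 K)) ≫
      AffineCoordBlowup.chartImm hπ (succ_mem_centreVars (Finset.mem_sdiff.mp l.2).1)
  haveI hφ : ∀ l, IsOpenImmersion (φ l) := fun l => by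
    by_cases hlj : l.1 = j
    · simp only [φ, dif_pos hlj, hφⱼ]
      infer_instance
    · simp only [φ, dif_neg hlj]
      haveI := hisof l hlj
      infer_instance
  refine hasSNCWith_of_cover_comap φ hsncW ?_ fun l => ?_
  · -- the re-centred charts cover `V(Zc)`
    intro w hw
    obtain ⟨l, hl⟩ := Set.mem_iUnion.mp (hcov hw)
    obtain ⟨hl, hw'⟩ := Set.mem_iUnion.mp hl
    refine Set.mem_iUnion.mpr ⟨⟨l, hl⟩, ?_⟩
    by_cases hlj : l = j
    · subst hlj
      simp only [φ, dif_pos rfl, hφⱼ]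
      rw [range_specMap_comp_chartImm]
      exact hw'
    · simp only [φ, dif_neg hlj]
      rw [range_specMap_comp_chartImm]
      exact hw'
  · by_cases hlj : l.1 = j
    · -- the `x_j`-chart
      simp only [φ, dif_pos hlj]
      rw [hφⱼ, comap_globalCentre, MarkedIdeal.transform_boundary]
      exact hasSNCWith_boundary_readings_translate_chart_far hj hjS' hbj ms fs c d hc hfs hsj hH1 hH2 hπ
    · -- a shear chart `x_l`
      simp only [φ, dif_neg hlj]
      rw [hZf l hlj, MarkedIdeal.transform_boundary]
      obtain ⟨hlS, hlS'⟩ := Finset.mem_sdiff.mp l.2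
      haveI := hisof l hlj
      exact hasSNCWith_boundary_readings_shear_chart_far hlS hlS' hj hjS' (Ne.symm hlj) ms fs c d hc hfs (hτf l hlj) (hτjf l hlj)
        (hτlf l hlj) (hτSf l hlj) (hτkf l hlj) hB1 hB2 hH1 hH2 hπ

end ChartDictionary

end Summit.ResolutionOfSingularities.ResolutionOfSingularities.Theorems.PIDim4

end
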